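import Summits.SmoothPoincare4.SmoothPoincare4.Theses.OneHandleSplitting
import Literature.Topology.FourManifolds.MappingTorus
import HarnessLib.Audit

/-!
# Birth skeleton for crux `OneHandleSplitting.FibrationRecognition` (item stmt-SmoothPoincare4-8117)

Route `route-SmoothPoincare4-OneHandleSplitting`, crux rank 2 (skeleton registrar, 2026-08-17).

Crux (FIXED, never restated; decl
`Summit.SmoothPoincare4.SmoothPoincare4.Theses.OneHandleSplitting.FibrationRecognition`):
`H1 → H2 → H3 → ∀ κ > 0, ∃ δ > 0, ∀ P` closed smooth 4-manifold with `P ≃ₕ S¹×S³`, `∀ g` `C^∞`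
Riemannian with Levi-Civita connection, `diam ≤ 1 → sec ≥ −κ (Gram form) → Ric ≥ −δ g →
Nonempty (P ≃ₘ S¹×S³)`, where the three antecedents are VERBATIM the route's apex-input items
`H1 = PoincareThreeSphere` (Perelman: closed simply connected smooth 3-manifold `≅ S³`),
`H2 = CerfTwoComponents` (Cerf 1968, pigeonhole form: among three self-diffeomorphisms of `S³` two
are smoothly isotopic through embeddings) and `H3 = CircleFibration` (Huang–Huang–Wang–Zhu 2026,
arXiv:2605.24380 Main Thm 1 at `n = 4`, `b₁ = 1`: such `(P, g)` admits a smooth submersion onto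
`S¹` with connected fibres).

## The line (= the route's own foreseen split (a) FibresOverCircle → FibreIsThreeSphere →
MappingTorusOfSphereStandard, typed over the tree's relational mapping torus
`Literature.Topology.FourManifolds.IsMappingTorusOf`)

Given `κ`, take `δ := δ(4, κ)` from `H3`. For `(P, g)` in the class, `H3` gives a smooth submersion
`f : P → S¹` with connected fibres. Then:

* `stub_mappingTorus` (EHRESMANN + MONODROMY, known; Ehresmann 1950 / Bröcker–Jänich (8.12);
  Hatcher AT Ex. 2.48): a smooth submersion of a CLOSED 4-manifold onto `S¹` with connected fibres is
  a smooth fibre bundle, hence `P` is a smooth mapping torus (`IsMappingTorusOf (𝓡 4) P φ`) of the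
  monodromy `φ : F ≃ₘ F` of the fibre `F = f⁻¹(θ₀)`, a closed connected smooth 3-manifold.
  [difficulty L: Ehresmann for proper submersions over `S¹` + the open-gluing presentation.]
* `stub_fibreSimplyConnected` (HOMOTOPY SEQUENCE, known; Hatcher AT Thm 4.41 / Prop. 1.40 for the
  `ℤ`-cover `F × ℝ`): if a closed 4-manifold `P ≃ₕ S¹×S³` is a mapping torus of `φ : F ≃ₘ F` with
  `F` closed CONNECTED, then `F` is simply connected (`π₂(S¹) = 0 → π₁F ↪ π₁P ≅ ℤ ↠ π₁S¹ ≅ ℤ`, a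
  surjection `ℤ → ℤ` is injective, so `π₁F = 1`). Connectedness of `F` is load-bearing (the swap on
  `S³ ⊔ S³` has mapping torus `S¹×S³`). [difficulty M–L: covering/LES of the mapping torus.]
* `stub_torusStandard` (PERELMAN TRANSPORT + ORIENTABILITY + CERF, known given `H1`, `H2`; the
  HARDEST stub formally): `H1 → H2 →` a closed 4-manifold `P ≃ₕ S¹×S³` that is a mapping torus of a
  self-diffeomorphism `φ` of a closed SIMPLY CONNECTED 3-manifold `F` is diffeomorphic to `S¹×S³`:
  `F ≅ S³` by `H1` (transport `φ` to `ψ ∈ Diff(S³)`), `P` orientable (`H₄(P;ℤ) ≅ ℤ`, homotopy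
  invariant) so `ψ` preserves orientation, `H2` with `(id, ψ, ρ)` (`ρ` a reflection; degree excludes
  the two mixed cases) makes `ψ` smoothly isotopic to `id`, isotopic monodromies have diffeomorphic
  mapping tori, and the mapping torus of `id_{S³}` is `S¹×S³` with the product model
  `(𝓡 1).prod (𝓡 3)`. [difficulty XL formally; CerfDiffeoSphere1968, Hatcher1983,
  CappellShaneson1976 §1; tree: `IsMappingTorusOf.diffeomorph_comp`, `cerf_pi0Diff_sphere_three`,
  `isDiffeotopicToId_of_isOrientationPreserving_of_pi0Diff` are the nearby tools.]

`FibrationRecognition_of : Sig.stub_mappingTorus → Sig.stub_fibreSimplyConnected →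
Sig.stub_torusStandard → FibrationRecognition` is PROVED below (pure logic, no `sorry`); the only
`sorry`s of the file are the three `stub_*` bodies. The statements live in `Sig.stub_*` so that the
hypothesis heads of `FibrationRecognition_of` carry the registered stub names (device of
`Cruxes/EveryMetricHearsSphere/Lines/birth.lean`). The closed composition is an `example` only, so
that no pre-composed constant of type `FibrationRecognition` enters the environment (BC3 probes
importing this file cannot close `stub → crux` by `exact?` through it; device of
`Cruxes/MultiplicityFour/Lines/birth.lean`).

## Disproof.lean honoured / negatives

`ledger crux ls stmt-SmoothPoincare4-8117`: no workfiles (no `Disproof.lean`, no `_false_without_`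
obstructions) on 2026-08-17; `ledger negatives --problem SmoothPoincare4`: 0 refuted statements; no
landed `Theorems/FibrationRecognition/Negative/*`. Nothing to honour beyond the crux's own
hypotheses: the line USES `H3` (in `FibrationRecognition_of`, to produce the submersion), `H1` and
`H2` (inside `stub_torusStandard`).
-/

noncomputable section

-- the prescribed namespace `Summit.<P>.<Sub>.…` duplicates `SmoothPoincare4` (P = Sub)
set_option linter.dupNamespace false
set_option linter.unusedVariables false

open scoped Manifold ContDiff Topology ContinuousMap
open Set Function

namespace Summit.SmoothPoincare4.SmoothPoincare4.Cruxes.FibrationRecognition.Birth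

open Summit.SmoothPoincare4.SmoothPoincare4.Theses.OneHandleSplitting
open Literature.Topology.FourManifolds (IsMappingTorusOf)

/-- Local notation: the model space `ℝ³` of the fibre. -/
local notation "ℝ³" => EuclideanSpace ℝ (Fin 3)
/-- Local notation: the model space `ℝ⁴` of the total space. -/
local notation "ℝ⁴" => EuclideanSpace ℝ (Fin 4)
/-- Local notation: the round unit circle `S¹ ⊂ ℝ²` (Mathlib's `C^∞` structure, model `𝓡 1`). -/
local notation "𝕊¹" => (Metric.sphere (0 : EuclideanSpace ℝ (Fin 2)) 1)
/-- Local notation: the round unit `3`-sphere `S³ ⊂ ℝ⁴` (model `𝓡 3`). -/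
local notation "𝕊³" => (Metric.sphere (0 : EuclideanSpace ℝ (Fin 4)) 1)

/-! ## Stub signatures (`Sig.stub_*`: the hypothesis heads of `FibrationRecognition_of` carry the
registered stub names) -/

/-- STUB 1 — EHRESMANN + MONODROMY. A smooth submersion `f` of a closed smooth 4-manifold `P` onto
the circle all of whose fibres are connected presents `P` as a smooth mapping torus
(`IsMappingTorusOf (𝓡 4) P φ`: open gluing of `F × (0,1)` and `F × (1/2,3/2)`) of a
self-diffeomorphism `φ` of a closed connected smooth 3-manifold `F` (the fibre `f⁻¹(θ₀)` with its
regular-level-set structure, `φ` the monodromy of the fibre bundle `f`, which is locally trivial by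
Ehresmann's lemma since `P` is compact). [cite: Ehresmann1950; BrockerJanich1982, (8.12);
HatcherAT2002, Ex. 2.48; arXiv:2605.24380, p. 14 ("F is a smooth fiber bundle map")] -/
def Sig.stub_mappingTorus : Prop :=
  ∀ (P : Type) [TopologicalSpace P] [T2Space P] [SecondCountableTopology P] [ChartedSpace ℝ⁴ P]
    [IsManifold (𝓡 4) ∞ P] [CompactSpace P] (f : P → 𝕊¹),
    ContMDiff (𝓡 4) (𝓡 1) ∞ f → (∀ x : P, Function.Surjective (mfderiv (𝓡 4) (𝓡 1) f x)) →
    (∀ θ : 𝕊¹, IsConnected (f ⁻¹' {θ})) →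
      ∃ (F : Type) (_ : TopologicalSpace F) (_ : T2Space F) (_ : SecondCountableTopology F)
        (_ : ChartedSpace ℝ³ F) (_ : IsManifold (𝓡 3) ∞ F) (_ : CompactSpace F)
        (_ : ConnectedSpace F) (φ : F ≃ₘ⟮𝓡 3, 𝓡 3⟯ F), IsMappingTorusOf (𝓡 4) P φ

/-- STUB 2 — THE FIBRE OF A HOMOTOPY `S¹×S³` IS SIMPLY CONNECTED. If a closed smooth 4-manifold `P`
homotopy equivalent to `S¹×S³` is a smooth mapping torus of a self-diffeomorphism `φ` of a closed
CONNECTED smooth 3-manifold `F`, then `F` is simply connected: the bundle `F → P → S¹` (equivalently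
the `ℤ`-cover `F × ℝ → P`) gives `π₁F ≅ ker (π₁P → π₁S¹)` with `π₁P ≅ ℤ → ℤ` onto (fibre connected),
hence injective. Without `ConnectedSpace F` it is false (swap of `S³ ⊔ S³`).
[cite: HatcherAT2002, Thm 4.41 and Prop. 1.40; CappellShaneson1976, §1] -/
def Sig.stub_fibreSimplyConnected : Prop :=
  ∀ (F : Type) [TopologicalSpace F] [T2Space F] [SecondCountableTopology F] [ChartedSpace ℝ³ F]
    [IsManifold (𝓡 3) ∞ F] [CompactSpace F] [ConnectedSpace F] (φ : F ≃ₘ⟮𝓡 3, 𝓡 3⟯ F)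
    (P : Type) [TopologicalSpace P] [T2Space P] [SecondCountableTopology P] [ChartedSpace ℝ⁴ P]
    [IsManifold (𝓡 4) ∞ P] [CompactSpace P],
    IsMappingTorusOf (𝓡 4) P φ → P ≃ₕ (𝕊¹ × 𝕊³) → SimplyConnectedSpace F

/-- STUB 3 — MAPPING TORI OVER SIMPLY CONNECTED FIBRES WITH THE HOMOTOPY TYPE OF `S¹×S³` ARE
STANDARD (given the crux's own antecedents `H1 = PoincareThreeSphere`, `H2 = CerfTwoComponents`).
A closed smooth 4-manifold `P ≃ₕ S¹×S³` which is a smooth mapping torus of a self-diffeomorphism `φ`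
of a closed simply connected smooth 3-manifold `F` is diffeomorphic to `S¹×S³` (product model):
`F ≅ S³` (H1) transports `φ` to `ψ ∈ Diff(S³)`; `P` is orientable (`H₄ ≅ ℤ` is a homotopy
invariant), so `ψ` preserves orientation; by H2 applied to `(id, ψ, ρ)` with `ρ` a reflection
(degree rules out `ψ ∼ ρ` and `id ∼ ρ`) `ψ` is smoothly isotopic to `id`; isotopic monodromies have
diffeomorphic mapping tori and the mapping torus of `id_{S³}` is `S¹×S³`.
[cite: CerfDiffeoSphere1968, Ch. I §1 Thm 1; Hatcher1983; CappellShaneson1976, §1;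
Perelman2002; Perelman2003a; MorganTian2007, Cor. 0.2] -/
def Sig.stub_torusStandard : Prop :=
  PoincareThreeSphere → CerfTwoComponents →
  ∀ (F : Type) [TopologicalSpace F] [T2Space F] [SecondCountableTopology F] [ChartedSpace ℝ³ F]
    [IsManifold (𝓡 3) ∞ F] [CompactSpace F] [SimplyConnectedSpace F] (φ : F ≃ₘ⟮𝓡 3, 𝓡 3⟯ F)
    (P : Type) [TopologicalSpace P] [T2Space P] [SecondCountableTopology P] [ChartedSpace ℝ⁴ P]
    [IsManifold (𝓡 4) ∞ P] [CompactSpace P],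
    IsMappingTorusOf (𝓡 4) P φ → P ≃ₕ (𝕊¹ × 𝕊³) →
      Nonempty (P ≃ₘ⟮𝓡 4, (𝓡 1).prod (𝓡 3)⟯ (𝕊¹ × 𝕊³))

/-! ## The three registered stubs (the only `sorry`s of the file) -/

/-- Registered stub 1 (Ehresmann + monodromy: submersion onto `S¹` with connected fibres ⇒ smooth
mapping torus of a closed connected 3-manifold). Size L. -/
theorem stub_mappingTorus : Sig.stub_mappingTorus := by
  sorry

/-- Registered stub 2 (homotopy sequence: fibre of a homotopy `S¹×S³` mapping torus is simply
connected). Size M–L. -/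
theorem stub_fibreSimplyConnected : Sig.stub_fibreSimplyConnected := by
  sorry

/-- Registered stub 3 (Perelman transport + orientability + Cerf: such a mapping torus is `S¹×S³`).
Size XL; the hardest stub. -/
theorem stub_torusStandard : Sig.stub_torusStandard := by
  sorry

/-! ## The composition (kernel-checked; no `sorry` of its own) -/

/-- **The skeleton concludes the crux BY NAME from the three stub statements.** Given the crux's
antecedents `H1 H2 H3` and `κ > 0`: `δ := δ(4, κ)` from `H3`; for `(P, g)` in the class `H3` gives a
smooth submersion `f : P → S¹` with connected fibres; stub 1 presents `P` as a mapping torus of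
`φ : F ≃ₘ F`, `F` closed connected; stub 2 makes `F` simply connected (`P ≃ₕ S¹×S³`); stub 3 (fed
`H1`, `H2`) gives `P ≅ S¹×S³`. -/
theorem FibrationRecognition_of :
    Sig.stub_mappingTorus → Sig.stub_fibreSimplyConnected → Sig.stub_torusStandard →
      FibrationRecognition := by
  intro h₁ h₂ h₃ H1 H2 H3 κ hκ
  obtain ⟨δ, hδ, H⟩ := H3 κ hκ
  refine ⟨δ, hδ, ?_⟩
  intro P _ _ _ _ _ _ e g _ hdiam hsec hric
  -- H3: a smooth submersion onto the circle with connected fibres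
  obtain ⟨f, hf, hsub, hconn⟩ := H P e g hdiam hsec hric
  -- stub 1: P is a smooth mapping torus of φ : F ≃ₘ F, F closed connected
  obtain ⟨F, _, _, _, _, _, _, _, φ, hT⟩ := h₁ P f hf hsub hconn
  -- stub 2: the fibre is simply connected
  haveI : SimplyConnectedSpace F := h₂ F φ P hT e
  -- stub 3: Perelman + Cerf
  exact h₃ H1 H2 F φ P hT e

/-- WIRING CHECK: the three sorried stubs compose to a closed term of the crux's type (modulo their
`sorry`s). Deliberately an `example` (no constant enters the environment). -/
example : FibrationRecognition :=
  FibrationRecognition_of stub_mappingTorus stub_fibreSimplyConnected stub_torusStandard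

end Summit.SmoothPoincare4.SmoothPoincare4.Cruxes.FibrationRecognition.Birth

end
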